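import Mathlib
import HarnessLib
import HarnessLib.Audit
import Summits.ValiantsHypothesis.Statement
import HarnessLib.Audit.Status.Attr

/-!
Route: LiouvilleSarnak

# Route LiouvilleSarnak — Möbius disjointness from VP — the Liouville family Λ_n = Σ λ(1+bin e) x^e
is in VNP and not in VP

It suffices to show X = LiouvilleNotInVP (card liouville-sarnak-ladder): the LIOUVILLE FAMILY
Λ_n(x) := Σ_{e ∈ {0,1}^n} λ(1 + bin e) · x^e ∈ ℂ[x_0, …, x_{n−1}] (λ = (−1)^Ω the Liouville
function, bin e = Σ e_i 2^i)
is not in VP_ℂ. Since Λ ∈ VNP_ℂ is a theorem provable now in the tree ([Ω(k) even] is a #P function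
with a UNIQUE
witness — the sorted prime factorisation, primes certified by AKS — so Valiant's criterion applies;
support item
LiouvilleInVNP), X gives VP_ℂ ≠ VNP_ℂ by one line of logic. The ENGINE proposed for X is the rank-2
crux AlgebraicSarnak
("Möbius disjointness from VP": no polynomial of polynomial circuit complexity has coefficient
vector with Ω(1) cosine
to λ on the cube), which kills Λ because Λ's self-cosine is 1 (support SarnakImpliesHard); the
digital rungs
DigitalBilinearLiouville ⊃ LiouvilleCutRank ⊃ AlignedCutRank are the ROABP/Nisan-width milestones of
the same ladder,
and HankelSpectralRank is the unconditional Vinogradov–Davenport rung for the Hankel sibling Σ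
λ(a+b+1) x^[a] y^[b].
Lean: `(⟨fun n => n, fun n => ∑ e : Fin n → Bool, MvPolynomial.C ((ArithmeticFunction.liouville
(Nat.ofBits e + 1) : ℤ) : ℂ) * ∏ i : Fin n, (if e i then MvPolynomial.X i else 1)⟩ :
Literature.Computability.AlgebraicComplexity.PolyFamily ℂ) ∉
Literature.Computability.AlgebraicComplexity.VP ℂ`

## Assembly
Pure logic (sorry-free in Sketch.lean, certified glue.lean): `ValiantsHypothesis` unfolds to VP ℂ ≠
VNP ℂ; given an equality
VP ℂ = VNP ℂ, rewrite LiouvilleInVNP (Λ ∈ VNP ℂ) into Λ ∈ VP ℂ and contradict LiouvilleNotInVP. The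
deciding theorem is
`closes (hT : LiouvilleNotInVP) (hN : LiouvilleInVNP) : _root_.ValiantsHypothesis`. The cruxes feed
the target through the support
glue: AlgebraicSarnak → (SarnakImpliesHard) → LiouvilleNotInVP; DigitalBilinearLiouville →
(BilinearImpliesCutRank) → LiouvilleCutRank →
AlignedCutRank are milestones (ROABP/Nisan-width hardness of Λ, consequences of the target's spirit,
not links of the assembly).

Rationale: WHY THIS LINE. The card transplants the Möbius-randomness principle (Sarnak2010ThreeLectures;
Boolean rungs in print: Green2012 for AC⁰
functions of the digits, Bourgain2013MoebiusWalsh for the Walsh spectrum, Mullner2017 for automatic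
sequences) into
Valiant's model with an explicit dictionary: "f computed in model M" ↦ "coefficient sequence class
S(M)", Möbius
disjointness on S(M) ↦ "nothing in M correlates with Λ_n", Nisan's cut matrices of Λ_{2n} ↦ DIGITAL
BILINEAR LIOUVILLE
SUMS sup_{‖u‖=‖w‖=1} |Σ u_r w_c λ(1 + L_S(r) + L_{S^c}(c))|, width/rank lower bound ↦ operator norm
(rank ≥ ‖M‖_F²/‖M‖_op²,
Eckart–Young), Hankel cut of the sibling H_n ↦ Vinogradov's exponential sum (IwaniecKowalski2004
§13, Davenport) — so the
separating family is a VNP member (Burgisser2000 Prop. 2.20 with AgrawalKayalSaxena2004 /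
FellowsKoblitz1992 unique
witnesses, all PROVED in the tree: PRIMES_mem_P_holds, P_subset_PPoly_holds, isVNPFamily_circuitSum)
carrying an EXTERNAL
hardness principle with ninety years of theorems (Siegel–Walfisz, Davenport,
MatomakiRadziwillAnnals2016,
MatomakiRadziwillTao2015, MatomakiRadziwillTao2020Fourier) instead of the permanent. Imported:
multiplicative number theory
/ pseudorandomness of λ (the engine), spectral-norm duality (the dictionary),
Nisan1991Noncommutative / Raz2009 /
RazYehudayoff2008 cut ranks (the algebraic side of the rungs). No prior route of this summit uses an
arithmetic function's
values as the coefficients of the separating family (nearest: route FeketeSOS — Legendre symbols, a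
PERIODIC symbol, in the
univariate SOS model via DST magnification); the negatives index (3 refuted statements: moment-curve
elusiveness, Grenet
uniqueness ×2) is untouched.

RANKED CRUXES. #0 LiouvilleNotInVP (target) — X — the Liouville family Λ = (Λ_n)_n, Λ_n =
Σ_{e∈{0,1}^n} λ(1 + bin e) x^e, bundled as a PolyFamily ℂ with n variables at level n, is not in
VP_ℂ (card: "Λ ∉ VP", the consequence of K1 that the assembly uses). (why it might fail: It is a
superpolynomial lower bound for an EXPLICIT VNP family against general circuits — no such bound
exists for any family; Λ would be VP-easy if λ could be synthesised on the whole cube from poly(n)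
characters, phases and constants (no candidate known).) [Burgisser2000, Burgisser1999,
Sarnak2010ThreeLectures, Green2012, Bourgain2013MoebiusWalsh]
#2 AlgebraicSarnak (crux) — ALGEBRAIC SARNAK (card K1, the engine): for every c and ε > 0, for all
large m, every f ∈ ℂ[x_0..x_{m−1}] of circuit complexity ≤ m^c + c satisfies |Σ_{e∈{0,1}^m} λ(1 +
bin e)·coeff_{x^e} f|² ≤ ε · 2^m · Σ_{all monomials d} |coeff_d f|² — the cosine between λ on the
cube and the coefficient vector of f (junk monomials counted in the norm) tends to 0 uniformly in
polynomial size. Trivial bound is ε = 1 (Cauchy–Schwarz); Λ_m itself has cosine 1. [difficulty: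
open-problem] (why it might fail: Far stronger than VH: it makes every biased multiplicative pattern
VP-hard ((−1)^{ω(k+1)} has cosine ≈ 0.47 with λ) and forbids synthesising λ on a positive fraction
of the cube from poly(n) characters/phases/constants; no structure theory of VP coefficient vectors
exists.) [Sarnak2010ThreeLectures, Green2012, Bourgain2013MoebiusWalsh, Mullner2017, Burgisser2000,
IwaniecKowalski2004]
#3 DigitalBilinearLiouville (crux) — DIGITAL BILINEAR LIOUVILLE SUMS (card K2): for every ε > 0 and
all large n, for EVERY balanced cut of the 2n bit positions (an equivalence π : Fin n ⊕ Fin n ≃ Fin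
2n assigning row bits and column bits) and all test vectors u, w : {0,1}^n → ℂ, |Σ_{r,c} u(r) w(c)
λ(1 + bin(r,c;π))|² ≤ ε · 4^n · ‖u‖² ‖w‖², i.e. the 2^n × 2^n cut matrix M_π of Λ_{2n} has operator
norm o(2^n) (Frobenius norm is exactly 2^n; random signs give ≈ 2·2^{n/2}; kit j003363 of the card:
σ_max/√N = 1.95–2.01 on nine random balanced cuts, n ≤ 22). [difficulty: open-problem] (why it might
fail: Needs a Type-II bound for λ against ARBITRARY unit vectors on digital rectangles at modulus √X
= 2^n (two-point correlations along progressions of modulus √X) — beyond Matomäki–Radziwiłł–Tao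
(intervals, small shifts); for adversarial cuts nothing is known.) [MatomakiRadziwillAnnals2016,
MatomakiRadziwillTao2015, MatomakiRadziwillTao2020Fourier, arXiv:1604.01041,
Bourgain2013MoebiusWalsh]
#4 LiouvilleCutRank (crux) — NISAN WIDTH OF Λ IS UNBOUNDED IN EVERY ORDER (card rung R2, rank form):
for every W and all large n, every balanced cut matrix M_π = (λ(1 + bin(r,c;π)))_{r,c ∈ {0,1}^n} of
Λ_{2n} has rank ≥ W over ℂ. By Nisan1991Noncommutative the maximum over prefix cuts of these ranks
is the ROABP width of Λ_{2n} in the corresponding variable order, so this is "no bounded-width ROABP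
for Λ in any order, eventually"; it follows from DigitalBilinearLiouville by rank ≥ ‖M‖_F²/‖M‖_op²
(support BilinearImpliesCutRank) but is far weaker (a ±1 matrix of rank W has ≤ 2^W distinct rows).
[deps: DigitalBilinearLiouville] [difficulty: L] (why it might fail: Bounded rank on ONE adversarial
balanced cut for infinitely many n means λ|[1,4^n] is spanned by ≤ 2^W sign patterns on digital
classes of size √X; no theorem excludes it — MR sign changes and pattern-entropy bounds live in
intervals, not digit classes.) [Nisan1991Noncommutative, MatomakiRadziwillAnnals2016,
MatomakiRadziwillTao2015, Mullner2017]
#5 AlignedCutRank (crux) — THE ALIGNED RUNG (entry point for analytic number theory; the bit-order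
special case of LiouvilleCutRank up to the shift convention): for every W and all large n the 2^n ×
2^n matrix (λ(a + 2^n b + 1))_{a,b<2^n} has rank ≥ W — equivalently the sign patterns of λ on the
2^n aligned intervals (2^n b, 2^n(b+1)] below 4^n span a space of unbounded dimension (rows are λ
along the progressions a+1 mod 2^n of modulus √X). Full rank with random-matrix singular values for
n ≤ 12 (card, kit j003363). [deps: LiouvilleCutRank] [difficulty: L] (why it might fail: Rank ≤ W
forces one length-√X sign pattern of λ to recur at ≥ √X/2^W aligned positions below X — plausibly
absurd, but recurrence at shifts that are multiples of √X is outside averaged Chowla (shifts o(X))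
and outside GRH-level results for λ in progressions mod √X.) [MatomakiRadziwillAnnals2016,
MatomakiRadziwillTao2015, IwaniecKowalski2004, Nisan1991Noncommutative]
#9 LiouvilleInVNP (support) — Λ ∈ VNP_ℂ (card P1; Valiant's criterion in #P form): E_n := Σ_e
[Ω(1+bin e) even] x^e = G_n(x, 1, …, 1) where G_n(x,y) = Σ_{e,w} ψ_n(e,w) x^e y^w and ψ_n(e,w) = [w
is the canonical code of the sorted prime factorisation of 1+bin e, certified by AKS, of even
length] ∈ P ⊆ P/poly (tree: Literature.Computability.QuantumComplexity.PRIMES_mem_P_holds,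
FactUP.coreFn / FACT_mem_UP_inter_coUP_holds for the unique-witness verifier, P_subset_PPoly_holds,
ValiantCriterion / isVNPFamily_circuitSum for G ∈ VNP), unique witness ⇒ coefficient exactly [Ω
even]; then Λ_n = 2E_n − Π_i(1+x_i) by closure of VNP under the projection y ↦ 1, scalars and
subtraction of the VP family Π(1+x_i) (Burgisser2000 §2.1–2.3). Load-bearing in `closes`.
[difficulty: provable-now] [Burgisser2000, Valiant1979, AgrawalKayalSaxena2004, FellowsKoblitz1992]
#9 SarnakImpliesHard (support) — glue of the engine to the target: AlgebraicSarnak →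
LiouvilleNotInVP. If Λ ∈ VP_ℂ then complexity(Λ_m) ≤ m^c + c for some c and all m (IsPComputable),
while for f = Λ_m the left side of AlgebraicSarnak is |Σ_e λ(1+bin e)²|² = 4^m and the right side is
ε·2^m·Σ_e |λ|² = ε·4^m (coeff_{x^e} Λ_m = λ(1 + bin e), support = the 2^m multilinear monomials:
orthogonality of the selector products Π_{i: e_i} X_i) — contradiction at ε = 1/2. [difficulty:
provable-now] [Burgisser2000]
#9 BilinearImpliesCutRank (support) — glue of rung R2: DigitalBilinearLiouville → LiouvilleCutRank,
by the linear-algebra inequality rank(M) ≥ ‖M‖_F² / ‖M‖_op² (sum of squared singular values ≤ rank ×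
largest) applied to the ±1 matrix M_π (‖M_π‖_F² = 4^n since every entry is λ of a positive integer,
and ‖M_π‖_op² ≤ ε·4^n by the crux), giving rank ≥ 1/ε. [difficulty: provable-now]
[Nisan1991Noncommutative, Raz2009]
#9 HankelSpectralRank (support) — the HANKEL RUNG R1, unconditional core (card P2): for every n and
B > 0, if sup_θ |Σ_{k<2^{n+1}} λ(k) e(kθ)| ≤ B then the 2^n × 2^n Hankel matrix H =
(λ(a+b+1))_{a,b<2^n} — the x|y-aligned cut matrix of H_n = Σ λ(a+b+1) x^[a] y^[b], up to row/column
permutation — satisfies 4^n ≤ B²·rank H. Proof: H[a,b] = ∫₀¹ S(θ) e(−(a+b+1)θ) dθ with S(θ) =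
Σ_{k<2^{n+1}} λ(k)e(kθ), so |u*Hw| ≤ B‖u‖‖w‖ by Cauchy–Schwarz and Parseval, i.e. ‖H‖_op ≤ B; ‖H‖_F²
= 4^n; rank ≥ ‖H‖_F²/‖H‖_op². With Davenport's bound (IwaniecKowalski2004 Thm 13.10, for λ via λ =
Σ_{d²|k} μ(k/d²)) this gives rank ≥ n^A for every A, and ≥ 2^{n/2−εn} under GRH (Baker–Harman).
[difficulty: provable-now] [IwaniecKowalski2004, MontgomeryVaughan2007, Nisan1991Noncommutative]

TWO-LAYER PLAN. Foreseen glued splits (none filed now): LiouvilleNotInVP ⇐ AlgebraicSarnak →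
SarnakImpliesHard → LiouvilleNotInVP (already the items);
SarnakForFormulas (the same law for multilinear-formula size m^c, where Raz-type full-rank
technology and the R3 square-root rung
‖M_S‖_op ≤ 2^{n/2+n^δ} meet) is a sibling MILESTONE of AlgebraicSarnak, not a split child (formulas
→ circuits is no glue). DigitalBilinearLiouville ⇐ MeanSquareTwoPoint (E_{r≠r'} |Σ_c λ(1+bin(r,c;π))
λ(1+bin(r',c;π))|² =
o(4^n), a Chowla-on-digital-classes statement) → GershgorinGlue (λ_max(MM*) ≤ 2^n +
‖offdiag(MM*)‖_F) → DigitalBilinearLiouville (k = 2).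
AlignedCutRank ⇐ PatternRecurrence (no length-h sign pattern of λ recurs at ≥ h/2^W aligned
positions below h², h large) →
DistinctColumnsGlue (rank W ⇒ ≤ 2^W distinct columns) → AlignedCutRank.

KILL CRITERIA. Refutation of LiouvilleNotInVP (Λ ∈ VP_ℂ: polynomial-size circuits for the Liouville
multilinear polynomials) closes the route
`refuted:LiouvilleNotInVP` and kills the card (it would also refute AlgebraicSarnak and be a
sensation in its own right).
Refutation of AlgebraicSarnak by an explicit VP family with non-vanishing λ-cosine kills the ENGINE
only: pivot — restate the law for
the class the witness does not reach (multilinear formulas / ROABPs / bounded depth) via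
`--restate`, keep the target and the digital
rungs; if the witness is a biased multiplicative pattern ((−1)^{ω}, λ_B with B = 2^{δn}) shown
VP-easy, the whole heuristic is dead:
close `refuted:AlgebraicSarnak`. Refutation of AlignedCutRank or LiouvilleCutRank (bounded rank on a
balanced cut infinitely often)
refutes DigitalBilinearLiouville too and exhibits digital structure in λ: drop the three rungs
(`--drop`), re-examine AlgebraicSarnak
against the structure found. VP ≠ VNP proved elsewhere moots the route; per_n ∉ VP proved elsewhere
does NOT moot X (Λ is
conjecturally VNP-intermediate) but makes it a side result.

NOT DECOMPOSED YET. Deliberately not filed at open: the card's K3 (Λ is not VNP-hard: per_m no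
p-projection of Λ_n — not load-bearing for VH, needs
Chowla-type independence far beyond reach, conceivably false) and P3 (random families are not
VNP-hard); the R3 square-root rung
(‖M_S‖_op ≤ 2^{n/2+n^δ} ⇒ multilinear-formula size n^{Ω(log n)} via Raz2009 / RazYehudayoff2008) —
needs syntactic-multilinear
formula size and Raz's theorem as tree facts first; the ROABP-width form of LiouvilleCutRank
(Nisan's characterisation is literature,
the rank form is filed instead); Davenport's bound for λ as a Literature named fact (turns
HankelSpectralRank into rank ≥ n^A; to be
requested as a cite item when a prover takes the rung); the R0 rung (Siegel–Walfisz ⇒ cosine → 0 for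
Dirichlet characters of conductor
≤ n^c, width-q ROABPs) as a provable special case of AlgebraicSarnak; definitions liouvillePoly /
cutMatrix (inlined instead).

CHEAPEST FALSIFIER. (i) The premise test, RUN by the card author (kit j003363, exact λ by sieve to
2^26): digital cut matrices in bit order (m ≤ 12) and
nine random balanced cuts (n ≤ 22) are full rank with σ_max/√N = 1.95–2.01 (random ±1 control
1.98–2.01), stable rank N/4.0; Hankel
[λ(a+b+1)] full rank; the VP pretender λ₇ (7-smooth part) is separated by BOUNDED stable rank ≈ 35 —
passed. (ii) Cheapest theorem-level
attack on AlgebraicSarnak: a VP family with λ-cosine ↛ 0 among Dirichlet characters of conductor ≤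
n^c (width-q ROABPs; killed
uniformly by Siegel–Walfisz exactly in the range q ≤ (log X)^c), linear phases Π(1+ζ^{2^i}x_i)
(Davenport), Thue–Morse / automatic
sequences (Mullner2017), AC⁰ digit functions (Green2012), λ_B sieves with B = O(log n) ((log B)²
e^{−c√n}) — all o(1); the first
UNTESTED classes a refuter should try: width-poly(n) ROABPs in non-bit orders and small formulas
with algebraic constants, n ≤ 26,
against the exact λ table. (iii) Literature: zbMATH/Crossref for "Liouville function" + (VNP |
arithmetic circuit | branching program)
— searchd was unavailable (rc 75) in both the card's session and this one; galaxy --star all and pdf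
bm25 found nothing.

NUMBERS. Cut matrices of Λ (card, kit j003363): σ_max/√N = 1.86, 1.99, 1.98, 2.00, 1.99, 2.00, 2.00
for bit-order cuts m = 6…12 (Bai–Yin edge 2;
random control 1.98–2.01), median σ/√N 0.81 (control 0.81), stable rank N/4.0; Walsh max_S |λ̂(S)|√N
= 3.4…6.0 for n = 10…26 on the
coin-flip curve √(2n ln 2) = 3.7…6.0; sup_θ |Σ_{k<N} λ(k)e(kθ)|/√N = 2.8, 3.4, 3.8 at N = 2^12,
2^16, 2^20. Theorems the rungs are measured
against: Davenport / IwaniecKowalski2004 Thm 13.10: Σ_{k≤x} μ(k)e(kα) ≪_A x(log x)^{−A} uniformly in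
α (same for λ); GRH ⇒ ≪ x^{3/4+ε}
(Baker–Harman 1991); Bourgain2013MoebiusWalsh Thm 1: max_A |Σ_{n<2^ℓ} μ(n) w_A(n)| < 2^{ℓ−ℓ^{1/10}};
MatomakiRadziwillAnnals2016: cancellation of
λ in almost all intervals of length h → ∞; Raz2009: multilinear formulas for full-rank polynomials
have size n^{Ω(log n)}; RazYehudayoff2008:
syntactically multilinear circuits Ω(n^{4/3}/log² n). VP calibration (card): sparse truncation
reaches cosine √(s/2^n); λ_B sieves of size
e^{O(B)} reach (log B)² e^{−c√n}; GRH predicts the optimum 2^{−n/2+o(n)}; X asks only o(1). Items at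
open: 10 (1 target, 4 cruxes, 4
support, 1 assembly).

DEFINITION REQUESTS. None needed to open: every item inlines Λ_n over Mathlib's
`ArithmeticFunction.liouville` and Batteries' `Nat.ofBits`, the tree's
`PolyFamily` / `VP` / `VNP` / `complexity` (Literature.Computability.AlgebraicComplexity) and
Mathlib's `Matrix.rank`. Nice-to-have later
(not filed now): `liouvillePoly n : MvPolynomial (Fin n) ℤ` and `cutMatrix` under
Literature/Computability/AlgebraicComplexity; cite fact
"Davenport-type bound for Σ λ(k)e(kθ)" under Literature/NumberTheory for the n^A form of
HankelSpectralRank.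

Novelty: Searches (2026-08-15, this session): `lit galaxy search "Liouville function arithmetic circuit"
--star all` (0 rows); `lit galaxy search
"Möbius function VNP" --star all` (0); `lit galaxy search --star pdf --mode bm25 "polynomial family
with Liouville or Moebius coefficients in
Valiant's VP versus VNP model, or a Sarnak Möbius disjointness conjecture for arithmetic circuits /
ABPs"` (15: Chatterjee–Kush–Saraf–Shpilka
CCC 2024 smABPs, Mahajan–Rao small-space VNP analogues, Grochow–Mulmuley–Qiao ICALP 2016,
Dutta–Gesmundo–Ikenmeyer arXiv:2311.17019, surveys
and workshop reports — none with an arithmetic function as coefficients); `lit search` all sources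
×2 (searchd rc 75, unavailable);
tree: `lean search liouville` (Mathlib ArithmeticFunction.liouville 2026;
Literature.Barriers.RiemannHypothesis.LiouvilleSignConjectures —
partial sums of λ, a different object), grep of all 58 Theses files of the summit for
liouville|sarnak|möbius|chowla (no mechanism hit),
`ledger negatives` (3, unrelated). Card's searches (2026-08-15): galaxy --star all "permanent versus
determinant" (6, none arithmetic),
"Möbius function using bounded depth circuits" (2: CIRM Sarnak volume, arXiv:1605.04628), pdf
intelligent on Möbius/Liouville lower bounds
for circuits/ABPs/VNP (12, none in Valiant's model), `lit frontier ValiantsHypothesis --since 2023`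
(30, none arithmetic-statistical), 121
pool cards grepped.
Nearest prior art found: Green2012 (AC⁰ functions of the digits do not compute μ — the Boolean l  [refs: 2311.17019, 1605.04628, Green2012, Burgisser1999, Burgisser2000]

Barriers (technique_class: arithmetic-pseudorandomness, spectral-norm-duality): - technique_class: arithmetic-pseudorandomness, spectral-norm-duality
- Literature.Barriers.ValiantsHypothesis.AlgebraicNaturalProofs: outside the class — AlgebraicSarnak
is an ORTHOGONALITY law "VP ⊥ λ" that random coefficient vectors also satisfy and one special VNP
family violates; it is neither a polynomial equation vanishing on VP nor a large/constructive
property separating VP from random, so Razborov–Rudich-type uselessness does not apply. Honest line: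
no structure theorem for general VP is evaded by a trick — the bet is that multiplicativity, Euler
products and Type I/II decompositions are structure the permanent lacks, and that Matomäki–Radziwiłł
technology climbs AlignedCutRank → LiouvilleCutRank → DigitalBilinearLiouville while AlgebraicSarnak
stays the honest open engine.
- Literature.Barriers.ValiantsHypothesis.FullRankMultilinear: rank is used only INSIDE the rungs
LiouvilleCutRank / AlignedCutRank / HankelSpectralRank and only up to its known ceilings (ROABP
width; a later R3 rung would stop at Raz's n^{Ω(log n)} by design); the target and AlgebraicSarnak
are not rank statements. Same answer for the RankMethods, RankLiftingBarrier,
ShiftedPartialDerivatives and UnpaddedShiftedPartials files.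
- Literature.Barriers.ValiantsHypothesis.PartialDerivativesDetPerm: not engaged — neither per nor
det is flattened; the only flattenings are cut matrices of Λ and H, fed by exponential / bilinear
sums rather than counted dimensions.
- Literature.Barriers.ValiantsHypothesis.

History (route lifecycle, newest last):
- 2026-08-16T04:21:15Z · AUTO-CRUX (backfill): LiouvilleNotInVP — hypotheses of the deciding theorem that nothing in the route derives are cruxes (operator:999:1085951)
- 2026-08-22T15:52:51Z · DORMANT — reconciler: no traction for 5.5 d (last activity item-evidence-added at 2026-08-17T04:14:35Z); parked, not closed — `ledger route dormant route-ValiantsHypothes (operator:999:530952)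
- 2026-08-26T06:33:53Z · REACTIVATED — reconciler: reactivated — activity statement-closed at 2026-08-26T06:07:16Z after parking at 2026-08-22T15:52:51Z (operator:999:392760)

sub-problem: ValiantsHypothesis · status: open · opened planner-plancard-ValiantsHypothesis-ValiantsH-cb7c755f-0 2026-08-15T19:12:09Z · rev 4 · ledger route-ValiantsHypothesis-LiouvilleSarnak
GENERATED by the gate from the ledger (D-0016/17). Provers cite these decls: `theorem foo : Summit.ValiantsHypothesis.ValiantsHypothesis.Theses.LiouvilleSarnak.<Decl> := …` in Summits/ValiantsHypothesis/ValiantsHypothesis/Theorems/<Name>.lean.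
-/

namespace Summit.ValiantsHypothesis.ValiantsHypothesis.Theses.LiouvilleSarnak

open scoped BigOperators Topology Manifold Classical MeasureTheory ProbabilityTheory Matrix InnerProductSpace ComplexConjugate ContinuousMap
open Filter Set Function TopologicalSpace MeasureTheory

attribute [summit_statement] _root_.ValiantsHypothesis

open Literature.PNP

/-- item stmt-ValiantsHypothesis-14772 · crux (kind.auto-crux: conjecture-grade) · rank 0 · open · by planner
why it might fail: It is a superpolynomial lower bound for an EXPLICIT VNP family against general circuits — no such bound exists for any family; Λ would be VP-easy if λ could be synthesised on the whole cube from poly(n) characters, phases and constants (no candidate known).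
sources: Burgisser2000, Burgisser1999, Sarnak2010ThreeLectures, Green2012, Bourgain2013MoebiusWalsh
[target] X — the Liouville family Λ = (Λ_n)_n, Λ_n = Σ_{e∈{0,1}^n} λ(1 + bin e) x^e, bundled as a
PolyFamily ℂ with n variables at level n, is not in VP_ℂ (card: "Λ ∉ VP", the consequence of K1 that
the assembly uses). -/
@[route_item "route-ValiantsHypothesis-LiouvilleSarnak", crux]
def LiouvilleNotInVP : Prop :=
  (⟨fun n => n, fun n => ∑ e : Fin n → Bool, MvPolynomial.C ((ArithmeticFunction.liouville (Nat.ofBits e + 1) : ℤ) : ℂ) * ∏ i : Fin n, (if e i then MvPolynomial.X i else 1)⟩ : Literature.Computability.AlgebraicComplexity.PolyFamily ℂ) ∉ Literature.Computability.AlgebraicComplexity.VP ℂ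

/-- item stmt-ValiantsHypothesis-14773 · crux · rank 2 · open · by planner
why it might fail: Far stronger than VH: it makes every biased multiplicative pattern VP-hard ((−1)^{ω(k+1)} has cosine ≈ 0.47 with λ) and forbids synthesising λ on a positive fraction of the cube from poly(n) characters/phases/constants; no structure theory of VP coefficient vectors exists.
sources: Sarnak2010ThreeLectures, Green2012, Bourgain2013MoebiusWalsh, Mullner2017, Burgisser2000, IwaniecKowalski2004
[crux] ALGEBRAIC SARNAK (card K1, the engine): for every c and ε > 0, for all large m, every f ∈
ℂ[x_0..x_{m−1}] of circuit complexity ≤ m^c + c satisfies |Σ_{e∈{0,1}^m} λ(1 + bin e)·coeff_{x^e}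
f|² ≤ ε · 2^m · Σ_{all monomials d} |coeff_d f|² — the cosine between λ on the cube and the
coefficient vector of f (junk monomials counted in the norm) tends to 0 uniformly in polynomial
size. Trivial bound is ε = 1 (Cauchy–Schwarz); Λ_m itself has cosine 1. [difficulty: open-problem] -/
@[route_item "route-ValiantsHypothesis-LiouvilleSarnak"]
def AlgebraicSarnak : Prop :=
  ∀ c : ℕ, ∀ ε : ℝ, 0 < ε → ∃ m₀ : ℕ, ∀ m ≥ m₀, ∀ f : MvPolynomial (Fin m) ℂ, Literature.Computability.AlgebraicComplexity.complexity f ≤ m ^ c + c → ‖∑ e : Fin m → Bool, ((ArithmeticFunction.liouville (Nat.ofBits e + 1) : ℤ) : ℂ) * MvPolynomial.coeff (Finsupp.equivFunOnFinite.symm fun i => (e i).toNat) f‖ ^ 2 ≤ ε * 2 ^ m * ∑ d ∈ f.support, ‖MvPolynomial.coeff d f‖ ^ 2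

/-- item stmt-ValiantsHypothesis-14774 · crux · rank 3 · open · by planner
why it might fail: Needs a Type-II bound for λ against ARBITRARY unit vectors on digital rectangles at modulus √X = 2^n (two-point correlations along progressions of modulus √X) — beyond Matomäki–Radziwiłł–Tao (intervals, small shifts); for adversarial cuts nothing is known.
sources: MatomakiRadziwillAnnals2016, MatomakiRadziwillTao2015, MatomakiRadziwillTao2020Fourier, arXiv:1604.01041, Bourgain2013MoebiusWalsh
[crux] DIGITAL BILINEAR LIOUVILLE SUMS (card K2): for every ε > 0 and all large n, for EVERY
balanced cut of the 2n bit positions (an equivalence π : Fin n ⊕ Fin n ≃ Fin 2n assigning row bits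
and column bits) and all test vectors u, w : {0,1}^n → ℂ, |Σ_{r,c} u(r) w(c) λ(1 + bin(r,c;π))|² ≤ ε
· 4^n · ‖u‖² ‖w‖², i.e. the 2^n × 2^n cut matrix M_π of Λ_{2n} has operator norm o(2^n) (Frobenius
norm is exactly 2^n; random signs give ≈ 2·2^{n/2}; kit j003363 of the card: σ_max/√N = 1.95–2.01 on
nine random balanced cuts, n ≤ 22). [difficulty: open-problem] -/
@[route_item "route-ValiantsHypothesis-LiouvilleSarnak", crux]
def DigitalBilinearLiouville : Prop :=
  ∀ ε : ℝ, 0 < ε → ∃ n₀ : ℕ, ∀ n ≥ n₀, ∀ π : Fin n ⊕ Fin n ≃ Fin (2 * n), ∀ u w : (Fin n → Bool) → ℂ, ‖∑ r : Fin n → Bool, ∑ c : Fin n → Bool, u r * w c * ((ArithmeticFunction.liouville (Nat.ofBits (fun j : Fin (2 * n) => Sum.elim r c (π.symm j)) + 1) : ℤ) : ℂ)‖ ^ 2 ≤ ε * 4 ^ n * (∑ r : Fin n → Bool, ‖u r‖ ^ 2) * (∑ c : Fin n → Bool, ‖w c‖ ^ 2)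

/-- item stmt-ValiantsHypothesis-14775 · crux · rank 4 · open · by planner
why it might fail: Bounded rank on ONE adversarial balanced cut for infinitely many n means λ|[1,4^n] is spanned by ≤ 2^W sign patterns on digital classes of size √X; no theorem excludes it — MR sign changes and pattern-entropy bounds live in intervals, not digit classes.
sources: Nisan1991Noncommutative, MatomakiRadziwillAnnals2016, MatomakiRadziwillTao2015, Mullner2017
[crux] NISAN WIDTH OF Λ IS UNBOUNDED IN EVERY ORDER (card rung R2, rank form): for every W and all
large n, every balanced cut matrix M_π = (λ(1 + bin(r,c;π)))_{r,c ∈ {0,1}^n} of Λ_{2n} has rank ≥ W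
over ℂ. By Nisan1991Noncommutative the maximum over prefix cuts of these ranks is the ROABP width of
Λ_{2n} in the corresponding variable order, so this is "no bounded-width ROABP for Λ in any order,
eventually"; it follows from DigitalBilinearLiouville by rank ≥ ‖M‖_F²/‖M‖_op² (support
BilinearImpliesCutRank) but is far weaker (a ±1 matrix of rank W has ≤ 2^W distinct rows). [deps:
DigitalBilinearLiouville] [difficulty: L] -/
@[route_item "route-ValiantsHypothesis-LiouvilleSarnak"]
def LiouvilleCutRank : Prop :=
  ∀ W : ℕ, ∃ n₀ : ℕ, ∀ n ≥ n₀, ∀ π : Fin n ⊕ Fin n ≃ Fin (2 * n), W ≤ (Matrix.of fun r c : Fin n → Bool => (((ArithmeticFunction.liouville (Nat.ofBits (fun j : Fin (2 * n) => Sum.elim r c (π.symm j)) + 1) : ℤ) : ℂ))).rank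

/-- item stmt-ValiantsHypothesis-14776 · crux · rank 5 · closed · proved by Summit.ValiantsHypothesis.ValiantsHypothesis.Theorems.LiouvilleSarnakAligned.alignedCutRank_proof (prover) · by planner
why it might fail: Rank ≤ W forces one length-√X sign pattern of λ to recur at ≥ √X/2^W aligned positions below X — plausibly absurd, but recurrence at shifts that are multiples of √X is outside averaged Chowla (shifts o(X)) and outside GRH-level results for λ in progressions mod √X.
sources: MatomakiRadziwillAnnals2016, MatomakiRadziwillTao2015, IwaniecKowalski2004, Nisan1991Noncommutative
[crux] THE ALIGNED RUNG (entry point for analytic number theory; the bit-order special case of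
LiouvilleCutRank up to the shift convention): for every W and all large n the 2^n × 2^n matrix (λ(a
+ 2^n b + 1))_{a,b<2^n} has rank ≥ W — equivalently the sign patterns of λ on the 2^n aligned
intervals (2^n b, 2^n(b+1)] below 4^n span a space of unbounded dimension (rows are λ along the
progressions a+1 mod 2^n of modulus √X). Full rank with random-matrix singular values for n ≤ 12
(card, kit j003363). [deps: LiouvilleCutRank] [difficulty: L] -/
@[route_item "route-ValiantsHypothesis-LiouvilleSarnak"]
def AlignedCutRank : Prop :=
  ∀ W : ℕ, ∃ n₀ : ℕ, ∀ n ≥ n₀, W ≤ (Matrix.of fun a b : Fin (2 ^ n) => (((ArithmeticFunction.liouville ((a : ℕ) + 2 ^ n * (b : ℕ) + 1) : ℤ) : ℂ))).rank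

-- `AlignedCutRank` holds: proved by `Summit.ValiantsHypothesis.ValiantsHypothesis.Theorems.LiouvilleSarnakAligned.alignedCutRank_proof` (its module imports this route file, so no `_holds` link can be stated here).

/-- item stmt-ValiantsHypothesis-14777 · support · rank 9 · closed · proved by Summit.ValiantsHypothesis.ValiantsHypothesis.Theorems.LiouvilleSarnak.LiouvilleVNP.liouvilleInVNP_proof (prover) · by planner
sources: Burgisser2000, Valiant1979, AgrawalKayalSaxena2004, FellowsKoblitz1992
[support] Λ ∈ VNP_ℂ (card P1; Valiant's criterion in #P form): E_n := Σ_e [Ω(1+bin e) even] x^e =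
G_n(x, 1, …, 1) where G_n(x,y) = Σ_{e,w} ψ_n(e,w) x^e y^w and ψ_n(e,w) = [w is the canonical code of
the sorted prime factorisation of 1+bin e, certified by AKS, of even length] ∈ P ⊆ P/poly (tree:
Literature.Computability.QuantumComplexity.PRIMES_mem_P_holds, FactUP.coreFn /
FACT_mem_UP_inter_coUP_holds for the unique-witness verifier, P_subset_PPoly_holds, ValiantCriterion
/ isVNPFamily_circuitSum for G ∈ VNP), unique witness ⇒ coefficient exactly [Ω even]; then Λ_n =
2E_n − Π_i(1+x_i) by closure of VNP under the projection y ↦ 1, scalars and subtraction of the VP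
family Π(1+x_i) (Burgisser2000 §2.1–2.3). Load-bearing in `closes`. [difficulty: provable-now] -/
@[route_item "route-ValiantsHypothesis-LiouvilleSarnak", crux]
def LiouvilleInVNP : Prop :=
  (⟨fun n => n, fun n => ∑ e : Fin n → Bool, MvPolynomial.C ((ArithmeticFunction.liouville (Nat.ofBits e + 1) : ℤ) : ℂ) * ∏ i : Fin n, (if e i then MvPolynomial.X i else 1)⟩ : Literature.Computability.AlgebraicComplexity.PolyFamily ℂ) ∈ Literature.Computability.AlgebraicComplexity.VNP ℂ

-- `LiouvilleInVNP` holds: proved by `Summit.ValiantsHypothesis.ValiantsHypothesis.Theorems.LiouvilleSarnak.LiouvilleVNP.liouvilleInVNP_proof` (its module imports this route file, so no `_holds` link can be stated here).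

/-- item stmt-ValiantsHypothesis-14778 · support · rank 9 · closed · proved by Summit.ValiantsHypothesis.ValiantsHypothesis.Theorems.LiouvilleSarnak.sarnakImpliesHard_proof (prover) · by planner
sources: Burgisser2000
[support] glue of the engine to the target: AlgebraicSarnak → LiouvilleNotInVP. If Λ ∈ VP_ℂ then
complexity(Λ_m) ≤ m^c + c for some c and all m (IsPComputable), while for f = Λ_m the left side of
AlgebraicSarnak is |Σ_e λ(1+bin e)²|² = 4^m and the right side is ε·2^m·Σ_e |λ|² = ε·4^m
(coeff_{x^e} Λ_m = λ(1 + bin e), support = the 2^m multilinear monomials: orthogonality of the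
selector products Π_{i: e_i} X_i) — contradiction at ε = 1/2. [difficulty: provable-now] -/
@[route_item "route-ValiantsHypothesis-LiouvilleSarnak"]
def SarnakImpliesHard : Prop :=
  AlgebraicSarnak → LiouvilleNotInVP

-- `SarnakImpliesHard` holds: proved by `Summit.ValiantsHypothesis.ValiantsHypothesis.Theorems.LiouvilleSarnak.sarnakImpliesHard_proof` (its module imports this route file, so no `_holds` link can be stated here).

/-- item stmt-ValiantsHypothesis-14779 · support · rank 9 · closed · proved by Summit.ValiantsHypothesis.ValiantsHypothesis.Theorems.LiouvilleSarnak.bilinearImpliesCutRank_proof (prover) · by planner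
sources: Nisan1991Noncommutative, Raz2009
[support] glue of rung R2: DigitalBilinearLiouville → LiouvilleCutRank, by the linear-algebra
inequality rank(M) ≥ ‖M‖_F² / ‖M‖_op² (sum of squared singular values ≤ rank × largest) applied to
the ±1 matrix M_π (‖M_π‖_F² = 4^n since every entry is λ of a positive integer, and ‖M_π‖_op² ≤
ε·4^n by the crux), giving rank ≥ 1/ε. [difficulty: provable-now] -/
@[route_item "route-ValiantsHypothesis-LiouvilleSarnak"]
def BilinearImpliesCutRank : Prop :=
  DigitalBilinearLiouville → LiouvilleCutRank

-- `BilinearImpliesCutRank` holds: proved by `Summit.ValiantsHypothesis.ValiantsHypothesis.Theorems.LiouvilleSarnak.bilinearImpliesCutRank_proof` (its module imports this route file, so no `_holds` link can be stated here).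

/-- item stmt-ValiantsHypothesis-14780 · support · rank 9 · closed · proved by Summit.ValiantsHypothesis.ValiantsHypothesis.Theorems.LiouvilleSarnakHankel.hankelSpectralRank_proof (prover) · by planner
sources: IwaniecKowalski2004, MontgomeryVaughan2007, Nisan1991Noncommutative
[support] the HANKEL RUNG R1, unconditional core (card P2): for every n and B > 0, if sup_θ
|Σ_{k<2^{n+1}} λ(k) e(kθ)| ≤ B then the 2^n × 2^n Hankel matrix H = (λ(a+b+1))_{a,b<2^n} — the
x|y-aligned cut matrix of H_n = Σ λ(a+b+1) x^[a] y^[b], up to row/column permutation — satisfies 4^n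
≤ B²·rank H. Proof: H[a,b] = ∫₀¹ S(θ) e(−(a+b+1)θ) dθ with S(θ) = Σ_{k<2^{n+1}} λ(k)e(kθ), so |u*Hw|
≤ B‖u‖‖w‖ by Cauchy–Schwarz and Parseval, i.e. ‖H‖_op ≤ B; ‖H‖_F² = 4^n; rank ≥ ‖H‖_F²/‖H‖_op². With
Davenport's bound (IwaniecKowalski2004 Thm 13.10, for λ via λ = Σ_{d²|k} μ(k/d²)) this gives rank ≥
n^A for every A, and ≥ 2^{n/2−εn} under GRH (Baker–Harman). [difficulty: provable-now] -/
@[route_item "route-ValiantsHypothesis-LiouvilleSarnak"]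
def HankelSpectralRank : Prop :=
  ∀ n : ℕ, ∀ B : ℝ, 0 < B → (∀ θ : ℝ, ‖∑ k ∈ Finset.range (2 ^ (n + 1)), ((ArithmeticFunction.liouville k : ℤ) : ℂ) * Complex.exp (2 * Real.pi * Complex.I * θ * k)‖ ≤ B) → (4 : ℝ) ^ n ≤ B ^ 2 * ((Matrix.of fun a b : Fin (2 ^ n) => (((ArithmeticFunction.liouville ((a : ℕ) + (b : ℕ) + 1) : ℤ) : ℂ))).rank : ℝ)

-- `HankelSpectralRank` holds: proved by `Summit.ValiantsHypothesis.ValiantsHypothesis.Theorems.LiouvilleSarnakHankel.hankelSpectralRank_proof` (its module imports this route file, so no `_holds` link can be stated here).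

/-- item stmt-ValiantsHypothesis-21039 · support · rank 9 · closed · proved by Summit.ValiantsHypothesis.ValiantsHypothesis.Theorems.LiouvilleSarnakCutRankFour.liouvilleCutRankFour_proof (prover) · by planner
[support] T5a rung W = 4 of LiouvilleCutRank (stmt-14775; tenure sweep TABLE row 29,
director-valiant g8 16:23:56Z): eventually, for EVERY balanced cut π of the 2n bit positions, the
2^n × 2^n digital cut matrix M_π = (λ(1 + bin(r,c;π))) of the Liouville function has rank ≥ 4 over ℂ
— λ∣[1,4^n] is not an 8-cell digital product pattern in any adversarial bit order (the W := 4
instance of 14775 verbatim; the aligned order for every W is AlignedCutRank stmt-14776 ✓ via Coons).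
Suggested mechanism (route header): density-subcube lemma + λ non-constant on Hilbert cubes of
powers of 2; refuter min-rank data over all balanced cuts, n = 1..7: 1, 3, 6, 15, 32, 64, 128. Why
it might fail: rank ≤ 3 on ONE adversarial balanced cut for infinitely many n only says λ∣[1,4^n] is
spanned by ≤ 8 sign patterns on digital classes of size √X in that order — Matomäki–Radziwiłł
sign-change and pattern-entropy bounds live on intervals, not digit classes, so nothing in print
excludes it; difficulty M/L. Sources: Nisan1991Noncommutative, MatomakiRadziwillAnnals2016,
MatomakiRadziwillTao2015, Mullner2017, tree LiouvilleSarnakAligned.alignedCutRank_proof. Elaborated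
in the planner folder (Sketch_T.lean rc 0). -/
@[route_item "route-ValiantsHypothesis-LiouvilleSarnak"]
def LiouvilleCutRankFour : Prop :=
  ∃ n₀ : ℕ, ∀ n ≥ n₀, ∀ π : Fin n ⊕ Fin n ≃ Fin (2 * n), 4 ≤ (Matrix.of fun r c : Fin n → Bool => (((ArithmeticFunction.liouville (Nat.ofBits (fun j : Fin (2 * n) => Sum.elim r c (π.symm j)) + 1) : ℤ) : ℂ))).rank

-- `LiouvilleCutRankFour` holds: proved by `Summit.ValiantsHypothesis.ValiantsHypothesis.Theorems.LiouvilleSarnakCutRankFour.liouvilleCutRankFour_proof` (its module imports this route file, so no `_holds` link can be stated here).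

/-- item stmt-ValiantsHypothesis-21040 · support · rank 9 · open · by planner
[support] T5b rung of DigitalBilinearLiouville (stmt-14774, HELD milestone; tenure sweep TABLE row
28, director-valiant g8 16:23:56Z) — ALIGNED TYPE-I form: λ has o(1) cancellation in ℓ¹-average over
the residues a < 2^n along the digital progressions a + 1 + 2^n·b, b < 2^n (modulus q = 2^n = √X,
length √X): Σ_{a<2^n} |Σ_{b<2^n} λ(a + 2^n b + 1)| ≤ ε·4^n for all large n. It is the special case u
= signs, w ≡ 1 of 14774 on the ALIGNED cut (|Σ u w λ|² ≤ ε·4^n·‖u‖²‖w‖² with ‖u‖² = ‖w‖² = 2^n),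
hence strictly weaker than the crux and the natural entry point for analytic number theory
(characters mod 2^n: real characters have conductor ∣ 8, so no Siegel zeros;
Postnikov–Gallagher–Iwaniec zero-free regions for powerful moduli). Why it might fail / why open: by
orthogonality it is equivalent to 'no Dirichlet character χ mod 2^n correlates with λ at length 4^n'
uniformly (one χ with |Σ_{m≤4^n} λ(m)χ(m)| ≫ 4^n kills it), and the modulus q = √X sits exactly at
the edge: PNT-type results for λ in progressions to prime-power moduli stop at q ≤ X^{5/12+o(1)}
(Gallagher 1972, Huxley/Iwaniec, Banks–Shparlinski) and q = √X needs density-hypothesis-strength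
zero density or GRH mod 2^n; numerics of -/
@[route_item "route-ValiantsHypothesis-LiouvilleSarnak"]
def AlignedTypeI : Prop :=
  ∀ ε : ℝ, 0 < ε → ∃ n₀ : ℕ, ∀ n ≥ n₀, ∑ a : Fin (2 ^ n), |∑ b : Fin (2 ^ n), ((ArithmeticFunction.liouville ((a : ℕ) + 2 ^ n * (b : ℕ) + 1) : ℤ) : ℝ)| ≤ ε * 4 ^ n

/-- item stmt-ValiantsHypothesis-14781 · assembly · rank 1 · closed · proved by Summit.ValiantsHypothesis.ValiantsHypothesis.Theorems.LiouvilleSarnak.assembly_proof (prover) · by planner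
sources: Burgisser2000, Valiant1979
[assembly] LiouvilleNotInVP → LiouvilleInVNP → ValiantsHypothesis (an equality VP ℂ = VNP ℂ would
move Λ from VNP into VP). -/
@[route_item "route-ValiantsHypothesis-LiouvilleSarnak"]
def Assembly : Prop :=
  LiouvilleNotInVP → LiouvilleInVNP → ValiantsHypothesis

-- `Assembly` holds: proved by `Summit.ValiantsHypothesis.ValiantsHypothesis.Theorems.LiouvilleSarnak.assembly_proof` (its module imports this route file, so no `_holds` link can be stated here).

/-! D-0027 §2.1 — DECIDING THEOREM (planner-authored via `route open/edit --closes-file`; by planner-plancard-ValiantsHypothesis-ValiantsH-cb7c755f-0 2026-08-15T19:12:09Z):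
its hypotheses are this route's items and its conclusion the sub-problem Statement (glue_lint), and it elaborates with this file. -/

@[closes "route-ValiantsHypothesis-LiouvilleSarnak"] theorem closes (hT : LiouvilleNotInVP) (hN : LiouvilleInVNP) : _root_.ValiantsHypothesis := by intro heq; apply hT; have h := hN; unfold LiouvilleInVNP at h; rw [← heq] at h; exact h

end Summit.ValiantsHypothesis.ValiantsHypothesis.Theses.LiouvilleSarnak
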